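import Literature.NumberTheory.Sieve.DrappeauDispersionMainTermsTools
import Literature.NumberTheory.Sieve.DrappeauDispersionMainKernel
import HarnessLib

/-!
# Drappeau 2017, §5.6: exchanging the moduli `q₁, q₂` with the primitive characters — proved

S. Drappeau, *Sums of Kloosterman sums in arithmetic progressions, and the error term in the
dispersion method*, Proc. London Math. Soc. (3) 114 (2017) 684–732 = arXiv:1504.05549
(`Drappeau2017`; held as `paper:arxiv-1504.05549`, §5.6 read on chunk 21).

The combinatorial heart of the bound for the main terms `X₁ − X₃` in §5.6: after expanding
`𝔲_R(·; (q₁,q₂))` over the primitive characters `ψ mod f`, `f ∣ (q₁, q₂)`, `f > R`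
(`…DrappeauDispersionKernelExpansion`) and bounding the weight `γ(q₁)γ(q₂)/([q₁,q₂]φ((q₁,q₂)))` by
`(1 + log L)²/(q₁q₂)` (`…DrappeauDispersionMainTermsTools`), one must exchange the double sum over
the moduli with the sum over `(f, ψ)` ("The sum over `q₁, q₂` is `O(1/(r²d₁d₂))` … by partial
summation", p. 21).  `sum_sum_inv_mul_sum_primIndex_gcd_le` does this for a general nonnegative
family `X(p, q₂)` attached to `p = (f, ψ)` and the modulus `q₂`, assuming only that on multiples of
the conductor `X(p, f k) ≤ Y(p, k)` (in the application, the character sum over `n` coprime to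
`f k` is the one over `n` coprime to `k`, `sum_filter_coprime_mul_inv_eq`):

`∑_{q₁,q₂ ∈ 𝒬'} (q₁q₂)⁻¹ ∑_{(f,ψ) ∈ primIndex (q₁,q₂), f > R} X((f,ψ), q₂)
   ≤ (1 + log L) ∑_{k ≤ L} k⁻¹ ∑_{R < f ≤ L} f⁻² ∑_{ψ mod f primitive} Y((f,ψ), k)`

for `𝒬' ⊆ [1, L]`; the right side is ready for the large sieve over conductors `> R`
(`LargeSieve.largeSieve_character_tail`) at each `k`.

Auxiliary: `primIndex_gcd_eq_filter` (`primIndex (q₁,q₂) = {p ∈ primIndex q₂ : p.1 ∣ q₁}`),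
`filter_primIndexLe_eq_sigma` (`{p ∈ primIndexLe L : R < p.1} = (Ioc R L).sigma (primitive)`).

## References

* S. Drappeau, Proc. London Math. Soc. (3) 114 (2017) 684–732, arXiv:1504.05549, §5.6. [Drappeau2017]
-/

noncomputable section

open Finset DirichletCharacter
open scoped Classical

namespace Literature.NumberTheory.Sieve

namespace Drappeau2017

/-! ### Index sets -/

/-- `primIndex (q₁, q₂) = {p ∈ primIndex q₂ : p.1 ∣ q₁}` for `q₁, q₂ ≠ 0`. [folklore] -/
theorem primIndex_gcd_eq_filter {q₁ q₂ : ℕ} (h₁ : q₁ ≠ 0) (h₂ : q₂ ≠ 0) :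
    primIndex (Nat.gcd q₁ q₂) = (primIndex q₂).filter (fun p => p.1 ∣ q₁) := by
  ext p
  rw [Finset.mem_filter, mem_primIndex, mem_primIndex, Nat.dvd_gcd_iff]
  have hg : Nat.gcd q₁ q₂ ≠ 0 := Nat.gcd_ne_zero_left h₁
  tauto

/-- `{p ∈ primIndexLe L : R < p.1} = (Ioc R L).sigma (primitive characters)`. [folklore] -/
theorem filter_primIndexLe_eq_sigma (R L : ℕ) :
    (primIndexLe L).filter (fun p => R < p.1) =
      (Ioc R L).sigma fun f => (univ : Finset (DirichletCharacter ℂ f)).filter IsPrimitive := by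
  ext p
  rw [Finset.mem_filter, mem_primIndexLe, Finset.mem_sigma, Finset.mem_filter, Finset.mem_Ioc]
  constructor
  · rintro ⟨⟨h1, hL, hprim⟩, hR⟩
    exact ⟨⟨hR, hL⟩, Finset.mem_univ _, hprim⟩
  · rintro ⟨⟨hR, hL⟩, -, hprim⟩
    exact ⟨⟨by omega, hL, hprim⟩, hR⟩

/-- For `q ∈ [1, L]`: a pair `(f, ψ*) ∈ primIndex q` with `R < f` lies in
`{p ∈ primIndexLe L : R < p.1}`. [folklore] -/
theorem mem_filter_primIndexLe_of_mem {q L R : ℕ} (hq : q ∈ Icc 1 L)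
    {p : Σ f : ℕ, DirichletCharacter ℂ f} (hp : p ∈ (primIndex q).filter (fun p => R < p.1)) :
    p ∈ (primIndexLe L).filter (fun p => R < p.1) := by
  rw [Finset.mem_filter] at hp ⊢
  obtain ⟨hpq, hq0, hprim⟩ := mem_primIndex.1 hp.1
  have hqL := (Finset.mem_Icc.1 hq)
  refine ⟨mem_primIndexLe.2 ⟨Nat.pos_of_dvd_of_pos hpq (by omega) , ?_, hprim⟩, hp.2⟩
  exact (Nat.le_of_dvd (by omega) hpq).trans hqL.2

/-! ### The exchange lemma -/

/-- **Exchanging the moduli with the primitive characters** (the mechanism of "The sum over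
`q₁, q₂` is `O(1/(r²d₁d₂))`" in Drappeau §5.6): for `𝒬' ⊆ [1, L]`, nonnegative `X, Y` with
`X((f,ψ), f k) ≤ Y((f,ψ), k)` for all `k`,
`∑_{q₁,q₂ ∈ 𝒬'} (q₁q₂)⁻¹ ∑_{(f,ψ) ∈ primIndex (q₁,q₂), f > R} X((f,ψ), q₂)
  ≤ (1 + log L) ∑_{k ≤ L} k⁻¹ ∑_{R < f ≤ L} f⁻² ∑_{ψ mod f primitive} Y((f,ψ), k)`
(the `q₁`-sum over multiples of `f` is `≤ (1 + log L)/f`, `sum_filter_dvd_inv_le`; then `q₂ = fk`).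
[cite: Drappeau2017, §5.6] -/
theorem sum_sum_inv_mul_sum_primIndex_gcd_le {𝒬' : Finset ℕ} {L : ℕ} (h𝒬' : 𝒬' ⊆ Icc 1 L)
    (R : ℕ) (X Y : (Σ f : ℕ, DirichletCharacter ℂ f) → ℕ → ℝ)
    (hX0 : ∀ p q, 0 ≤ X p q) (hY0 : ∀ p k, 0 ≤ Y p k) (hXY : ∀ p k, X p (p.1 * k) ≤ Y p k) :
    ∑ q₁ ∈ 𝒬', ∑ q₂ ∈ 𝒬', (((q₁ : ℝ)) * q₂)⁻¹ *
        ∑ p ∈ (primIndex (Nat.gcd q₁ q₂)).filter (fun p => R < p.1), X p q₂ ≤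
      (1 + Real.log L) * ∑ k ∈ Icc 1 L, ((k : ℝ))⁻¹ *
        ∑ f ∈ Ioc R L, (((f : ℝ)) ^ 2)⁻¹ *
          ∑ ψ ∈ (univ : Finset (DirichletCharacter ℂ f)).filter IsPrimitive, Y ⟨f, ψ⟩ k := by
  have hℓ0 : 0 ≤ 1 + Real.log L := by have := Real.log_natCast_nonneg L; linarith
  have hq0 : ∀ q ∈ 𝒬', q ≠ 0 := fun q hq => by have := (Finset.mem_Icc.1 (h𝒬' hq)).1; omega
  -- Step 1: the `q₁`-sum, for fixed `q₂`, is over the multiples of `f`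
  have step1 : ∀ q₂ ∈ 𝒬', ∑ q₁ ∈ 𝒬', (((q₁ : ℝ)) * q₂)⁻¹ *
        ∑ p ∈ (primIndex (Nat.gcd q₁ q₂)).filter (fun p => R < p.1), X p q₂ ≤
      (1 + Real.log L) * ∑ p ∈ (primIndex q₂).filter (fun p => R < p.1),
        (((q₂ : ℝ)) * p.1)⁻¹ * X p q₂ := by
    intro q₂ hq₂
    -- rewrite with indicators over the fixed index set `primIndex q₂`
    have hrew : ∀ q₁ ∈ 𝒬', (((q₁ : ℝ)) * q₂)⁻¹ *
        ∑ p ∈ (primIndex (Nat.gcd q₁ q₂)).filter (fun p => R < p.1), X p q₂ =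
        ∑ p ∈ (primIndex q₂).filter (fun p => R < p.1),
          (if p.1 ∣ q₁ then (((q₁ : ℝ)))⁻¹ else 0) * ((((q₂ : ℝ)))⁻¹ * X p q₂) := by
      intro q₁ hq₁
      rw [primIndex_gcd_eq_filter (hq0 q₁ hq₁) (hq0 q₂ hq₂), Finset.filter_filter, Finset.mul_sum]
      have hset : (primIndex q₂).filter (fun p => p.1 ∣ q₁ ∧ R < p.1) =
          ((primIndex q₂).filter (fun p => R < p.1)).filter (fun p => p.1 ∣ q₁) := by
        rw [Finset.filter_filter]
        exact Finset.filter_congr fun p _ => by tauto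
      rw [hset, Finset.sum_filter]
      refine Finset.sum_congr rfl fun p _ => ?_
      split_ifs
      · rw [mul_inv]; ring
      · rw [zero_mul]
    rw [Finset.sum_congr rfl hrew, Finset.sum_comm, Finset.mul_sum]
    refine Finset.sum_le_sum fun p hp => ?_
    rw [← Finset.sum_mul, ← Finset.sum_filter]
    have hp1 : 1 ≤ p.1 := by
      obtain ⟨hpq, -, -⟩ := mem_primIndex.1 (Finset.mem_filter.1 hp).1
      exact Nat.pos_of_dvd_of_pos hpq (Nat.pos_of_ne_zero (hq0 q₂ hq₂))
    have hV := sum_filter_dvd_inv_le (𝒬 := 𝒬') h𝒬' hp1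
    have hp0 : (0 : ℝ) < p.1 := by exact_mod_cast hp1
    have hq2 : (0 : ℝ) < q₂ := by exact_mod_cast Nat.pos_of_ne_zero (hq0 q₂ hq₂)
    calc (∑ q₁ ∈ 𝒬'.filter (fun q₁ => p.1 ∣ q₁), ((q₁ : ℝ))⁻¹) * ((((q₂ : ℝ)))⁻¹ * X p q₂)
        ≤ ((1 + Real.log L) / p.1) * ((((q₂ : ℝ)))⁻¹ * X p q₂) :=
          mul_le_mul_of_nonneg_right hV (mul_nonneg (by positivity) (hX0 p q₂))
      _ = (1 + Real.log L) * ((((q₂ : ℝ)) * p.1)⁻¹ * X p q₂) := by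
          rw [mul_inv]; ring
  -- Step 2: sum over `q₂`, and exchange `q₂` with `p`
  have step2 : ∑ q₂ ∈ 𝒬', ∑ p ∈ (primIndex q₂).filter (fun p => R < p.1),
        (((q₂ : ℝ)) * p.1)⁻¹ * X p q₂ =
      ∑ p ∈ (primIndexLe L).filter (fun p => R < p.1),
        ∑ q₂ ∈ 𝒬'.filter (fun q₂ => p.1 ∣ q₂), (((q₂ : ℝ)) * p.1)⁻¹ * X p q₂ := by
    refine Finset.sum_comm' fun q₂ p => ?_
    constructor
    · rintro ⟨hq₂, hp⟩
      refine ⟨?_, mem_filter_primIndexLe_of_mem (h𝒬' hq₂) hp⟩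
      rw [Finset.mem_filter]
      exact ⟨hq₂, (mem_primIndex.1 (Finset.mem_filter.1 hp).1).1⟩
    · rintro ⟨hq₂, hp⟩
      rw [Finset.mem_filter] at hq₂ hp
      refine ⟨hq₂.1, Finset.mem_filter.2 ⟨mem_primIndex.2 ⟨hq₂.2, hq0 q₂ hq₂.1, ?_⟩, hp.2⟩⟩
      exact (mem_primIndexLe.1 hp.1).2.2
  -- Step 3: for fixed `p`, `q₂ = f k` with `k ∈ [1, L]`, and `X(p, fk) ≤ Y(p, k)`
  have step3 : ∀ p ∈ (primIndexLe L).filter (fun p => R < p.1),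
      ∑ q₂ ∈ 𝒬'.filter (fun q₂ => p.1 ∣ q₂), (((q₂ : ℝ)) * p.1)⁻¹ * X p q₂ ≤
        ∑ k ∈ Icc 1 L, (((p.1 : ℝ)) ^ 2 * k)⁻¹ * Y p k := by
    intro p hp
    have hp1 : 1 ≤ p.1 := (mem_primIndexLe.1 (Finset.mem_filter.1 hp).1).1
    -- `q₂ ↦ q₂ / f` is injective on the multiples of `f` in `𝒬'`, with values in `[1, L]`
    set K := (𝒬'.filter (fun q₂ => p.1 ∣ q₂)).image (fun q₂ => q₂ / p.1) with hK
    have hKsub : K ⊆ Icc 1 L := by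
      intro k hk
      rw [hK, Finset.mem_image] at hk
      obtain ⟨q₂, hq₂, rfl⟩ := hk
      rw [Finset.mem_filter] at hq₂
      have hq₂L := Finset.mem_Icc.1 (h𝒬' hq₂.1)
      refine Finset.mem_Icc.2 ⟨?_, (Nat.div_le_self _ _).trans hq₂L.2⟩
      exact (Nat.le_div_iff_mul_le hp1).2 (by rw [one_mul]; exact Nat.le_of_dvd (by omega) hq₂.2)
    have himage : 𝒬'.filter (fun q₂ => p.1 ∣ q₂) = K.image (fun k => p.1 * k) := by
      rw [hK, Finset.image_image]
      symm
      refine (Finset.image_congr ?_).trans Finset.image_id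
      intro q₂ hq₂
      rw [Finset.mem_coe, Finset.mem_filter] at hq₂
      simp only [Function.comp_apply, id_eq]
      exact Nat.mul_div_cancel' hq₂.2
    have hinj : Set.InjOn (fun k => p.1 * k) (K : Set ℕ) :=
      fun a _ b _ h => Nat.eq_of_mul_eq_mul_left hp1 h
    rw [himage, Finset.sum_image hinj]
    calc ∑ k ∈ K, ((((p.1 * k : ℕ) : ℝ)) * p.1)⁻¹ * X p (p.1 * k)
        ≤ ∑ k ∈ K, (((p.1 : ℝ)) ^ 2 * k)⁻¹ * Y p k := by
          refine Finset.sum_le_sum fun k _ => ?_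
          have heq : ((((p.1 * k : ℕ) : ℝ)) * p.1)⁻¹ = (((p.1 : ℝ)) ^ 2 * k)⁻¹ := by
            push_cast; ring
          rw [heq]
          exact mul_le_mul_of_nonneg_left (hXY p k) (by positivity)
      _ ≤ ∑ k ∈ Icc 1 L, (((p.1 : ℝ)) ^ 2 * k)⁻¹ * Y p k :=
          Finset.sum_le_sum_of_subset_of_nonneg hKsub fun k _ _ =>
            mul_nonneg (by positivity) (hY0 p k)
  -- Step 4: assemble and rewrite the `p`-sum as a sum over `f` and `ψ`
  calc ∑ q₁ ∈ 𝒬', ∑ q₂ ∈ 𝒬', (((q₁ : ℝ)) * q₂)⁻¹ *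
          ∑ p ∈ (primIndex (Nat.gcd q₁ q₂)).filter (fun p => R < p.1), X p q₂
      = ∑ q₂ ∈ 𝒬', ∑ q₁ ∈ 𝒬', (((q₁ : ℝ)) * q₂)⁻¹ *
          ∑ p ∈ (primIndex (Nat.gcd q₁ q₂)).filter (fun p => R < p.1), X p q₂ := Finset.sum_comm
    _ ≤ ∑ q₂ ∈ 𝒬', (1 + Real.log L) * ∑ p ∈ (primIndex q₂).filter (fun p => R < p.1),
          (((q₂ : ℝ)) * p.1)⁻¹ * X p q₂ := Finset.sum_le_sum step1
    _ = (1 + Real.log L) * ∑ p ∈ (primIndexLe L).filter (fun p => R < p.1),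
          ∑ q₂ ∈ 𝒬'.filter (fun q₂ => p.1 ∣ q₂), (((q₂ : ℝ)) * p.1)⁻¹ * X p q₂ := by
        rw [← Finset.mul_sum, step2]
    _ ≤ (1 + Real.log L) * ∑ p ∈ (primIndexLe L).filter (fun p => R < p.1),
          ∑ k ∈ Icc 1 L, (((p.1 : ℝ)) ^ 2 * k)⁻¹ * Y p k :=
        mul_le_mul_of_nonneg_left (Finset.sum_le_sum step3) hℓ0
    _ = (1 + Real.log L) * ∑ k ∈ Icc 1 L, ((k : ℝ))⁻¹ *
          ∑ f ∈ Ioc R L, (((f : ℝ)) ^ 2)⁻¹ *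
            ∑ ψ ∈ (univ : Finset (DirichletCharacter ℂ f)).filter IsPrimitive, Y ⟨f, ψ⟩ k := by
        congr 1
        rw [Finset.sum_comm]
        refine Finset.sum_congr rfl fun k _ => ?_
        rw [filter_primIndexLe_eq_sigma, Finset.sum_sigma, Finset.mul_sum]
        refine Finset.sum_congr rfl fun f _ => ?_
        rw [Finset.mul_sum, Finset.mul_sum]
        refine Finset.sum_congr rfl fun ψ _ => ?_
        rw [mul_inv]
        ring

end Drappeau2017

end Literature.NumberTheory.Sieve

end
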